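import Summits.MatrixMultiplication.MatrixMultiplication.Theorems.AbelianSTPPCensusShapeCertVQSearchP
import Summits.MatrixMultiplication.MatrixMultiplication.Theorems.AbelianSTPPCensusShapeCertVQEvalP414a1
import Summits.MatrixMultiplication.MatrixMultiplication.Theorems.AbelianSTPPCensusShapeCertVQEvalP414a2
import Summits.MatrixMultiplication.MatrixMultiplication.Theorems.AbelianSTPPCensusShapeCertVQEvalP414a3
import Summits.MatrixMultiplication.MatrixMultiplication.Theorems.AbelianSTPPCensusShapeCertVQEvalP414b
import Summits.MatrixMultiplication.MatrixMultiplication.Theorems.AbelianSTPPCensusShapeCertVQEvalP414c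

/-!
# Abelian STPP census — the budgeted vQ certificate at order 414, assembled from its path segments

Cell mm-stpp, rung F-M1; successor kernel item VQ-CERT in support of the closed crux item stmt-MatrixMultiplication-19191; seat
mm-stpp-vp-p2 (gen 1); support file (no definitions, no kernel search).  Folds the kernel-evaluated path segments of
`…ShapeCertVQEvalP414a…` into `ShapeCertVQ.checkQE 414 = true` with `pathSegQE_append` / `pathOK_of_seg` / `pathSeg_single_of_child` /
`checkQE_of_pathOK_nil` (`…ShapeCertVQSearchP`).
WHAT THIS IS NOT: a Boolean fact; no statement about STPP families or `ω` by itself.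
-/

set_option linter.dupNamespace false -- `MatrixMultiplication.MatrixMultiplication` (summit = problem, D-0017)
set_option autoImplicit false

namespace Summit.MatrixMultiplication.MatrixMultiplication.Theorems.ShapeCertVQ

/-- the node `[0, 84]` of order `414` is accepted by the budgeted search -/
theorem pok_414_r_84_0 : PathOK 414 [0, 84] :=
  pathOK_of_seg (pathSegQE_append ps_414_r_84_0_0 ps_414_r_84_0_34) (lt_of_lt_of_le (pathNode_pool_lt 414 [0, 84]) (by norm_num)) (by norm_num)

/-- one-candidate path segment at node `[84]`, candidate `0`, from its child node -/
theorem ps_414_r_84_0 : pathSegQE 414 [84] 0 1 = true :=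
  pathSeg_single_of_child ps_414_r_84_69 pok_414_r_84_0 (by norm_num)

/-- the node `[84]` of order `414` is accepted by the budgeted search -/
theorem pok_414_r_84 : PathOK 414 [84] :=
  pathOK_of_seg (pathSegQE_append (pathSegQE_append (pathSegQE_append ps_414_r_84_0 ps_414_r_84_1) ps_414_r_84_7) ps_414_r_84_69) (lt_of_lt_of_le (pathNode_pool_lt 414 [84]) (by norm_num)) (by norm_num)

/-- the node `[85]` of order `414` is accepted by the budgeted search -/
theorem pok_414_r_85 : PathOK 414 [85] :=
  pathOK_of_seg (pathSegQE_append (pathSegQE_append ps_414_r_85_0 ps_414_r_85_6) ps_414_r_85_72) (lt_of_lt_of_le (pathNode_pool_lt 414 [85]) (by norm_num)) (by norm_num)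

/-- one-candidate path segment at node `[]`, candidate `84`, from its child node -/
theorem ps_414_r_84 : pathSegQE 414 [] 84 1 = true :=
  pathSeg_single_of_child ps_414_r_5341 pok_414_r_84 (by norm_num)

/-- one-candidate path segment at node `[]`, candidate `85`, from its child node -/
theorem ps_414_r_85 : pathSegQE 414 [] 85 1 = true :=
  pathSeg_single_of_child ps_414_r_5341 pok_414_r_85 (by norm_num)

/-- the node `[]` of order `414` is accepted by the budgeted search -/
theorem pok_414_r : PathOK 414 [] :=
  pathOK_of_seg (pathSegQE_append (pathSegQE_append (pathSegQE_append (pathSegQE_append (pathSegQE_append (pathSegQE_append (pathSegQE_append (pathSegQE_append (pathSegQE_append ps_414_r_0 ps_414_r_84) ps_414_r_85) ps_414_r_86) ps_414_r_91) ps_414_r_92) ps_414_r_110) ps_414_r_113) ps_414_r_851) ps_414_r_5341) (lt_of_lt_of_le (pathNode_pool_lt 414 []) (by norm_num)) (by norm_num)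

/-- **budgeted vQ certificate check at order `414`**, assembled from its path segments -/
theorem checkQE_414 : checkQE 414 = true := checkQE_of_pathOK_nil pok_414_r

end Summit.MatrixMultiplication.MatrixMultiplication.Theorems.ShapeCertVQ
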